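import Mathlib
import Summits.Parity.BatemanHorn.Theorems.IsogenyRedeiSplitBlockJacobiTransfer
import Summits.Parity.BatemanHorn.Theorems.IsogenyRedeiSplitBlockJacobiDigitReparametrisation
import HarnessLib

/-!
# Crux `SplitBlockJacobi` (stmt-Parity-11583, route `IsogenyRedei`), line `split-mass-middle-prime`:
# the converse (easy) direction of the glue

The crux is `∀ θ ∈ (1/2, 1), J_θ(x) = o(x)` with
`J_θ(x) := Σ_{1 ≤ t ≤ x} Σ_{Q < Q′ prime factors of t²+1, Q > x^θ} (Q | Q′)`, and for `θ < θ′` the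
MIDDLE-PRIME sum `M_{θ,θ′}(x)` is the same sum restricted to `x^θ < Q ≤ x^{θ′}`.

The landed glue of the line (`splitBlockJacobi_of_middlePrimeJacobi`,
`splitBlockJacobi_of_factoredMiddleCancels`, p76701) proves
`FactoredMiddleCancels → MiddlePrimeJacobi → SplitBlockJacobi`.  This file adds the two converse
(easy) implications, so that all three statements are EQUIVALENT by kernel-checked theorems:

* `middlePrimeJacobi_of_splitBlockJacobi` : for `x ≥ 1` and `θ ≤ θ′` LITERALLY
  `J_θ(x) = M_{θ,θ′}(x) + J_{θ′}(x)` (`pairSumLit_eq_middle_add`), so `M_{θ,θ′} = J_θ − J_{θ′}`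
  eventually, and the crux at `θ` and at `θ′` gives `M_{θ,θ′} = o(x)`;
* `factoredMiddleCancels_of_splitBlockJacobi` : by the LANDED dictionary bound
  `DigitReparam.abs_middle_sub_factored_le` (`|M_{θ,θ′}(x) − factored(x)| ≤ 12 (x^{θ′} + 1)` for
  `x ≥ 4`) and `x^{θ′} = o(x)` (`DigitReparam.rpow_isLittleO_natCast`), `M_{θ,θ′} = o(x)` gives
  `factored = o(x)` — the transport of `stub_digitReparametrisation`, run backwards.

The two `Iff` corollaries `splitBlockJacobi_iff_middlePrimeJacobi` and
`splitBlockJacobi_iff_factoredMiddleCancels` record the equivalences.  All statements are over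
the literal sums (no definitions).
-/

noncomputable section

open Filter Finset Asymptotics
open scoped Classical

namespace Summit.Parity.BatemanHorn.Cruxes.SplitBlockJacobi.SplitMassMiddlePrime

/-! ### Crux `→` middle-prime cancellation -/

/-- **Registered (line `split-mass-middle-prime`), converse (easy) direction**: the crux
`SplitBlockJacobi` implies middle-prime cancellation `M_{θ,θ′}(x) = o(x)` for all
`1/2 < θ < θ′ < 1`.  For `x ≥ 1`, `J_θ(x) = M_{θ,θ′}(x) + J_{θ′}(x)` literally
(`pairSumLit_eq_middle_add`), so `M_{θ,θ′} = J_θ − J_{θ′}` eventually, and both `J_θ`, `J_{θ′}` are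
`o(x)` by the crux.  With `splitBlockJacobi_of_middlePrimeJacobi` /
`splitBlockJacobi_of_factoredMiddleCancels` (p76701) the crux is EQUIVALENT to middle-prime /
factored cancellation. -/
theorem middlePrimeJacobi_of_splitBlockJacobi :
    Summit.Parity.BatemanHorn.Theses.IsogenyRedei.SplitBlockJacobi → ∀ θ θ' : ℝ, 1 / 2 < θ →
      θ < θ' → θ' < 1 →
      (fun x : ℕ => ∑ t ∈ Finset.Icc 1 x,
          ∑ q ∈ ((t ^ 2 + 1).primeFactors ×ˢ (t ^ 2 + 1).primeFactors).filter
            (fun q : ℕ × ℕ => (x : ℝ) ^ θ < (q.1 : ℝ) ∧ (q.1 : ℝ) ≤ (x : ℝ) ^ θ' ∧ q.1 < q.2),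
            (jacobiSym (q.1 : ℤ) q.2 : ℝ))
        =o[Filter.atTop] fun x : ℕ => (x : ℝ) := by
  intro hJ θ θ' hθ hθθ' hθ'1
  have h1 := hJ θ hθ (hθθ'.trans hθ'1)
  have h2 := hJ θ' (hθ.trans hθθ') hθ'1
  refine (h1.sub h2).congr' ?_ Filter.EventuallyEq.rfl
  filter_upwards [Filter.eventually_ge_atTop 1] with x hx
  rw [pairSumLit_eq_middle_add θ θ' x hx hθθ'.le, add_sub_cancel_right]

/-! ### Crux `→` factored middle cancellation -/

open DigitReparam in
/-- **Registered (line `split-mass-middle-prime`), converse (easy) direction**: the crux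
`SplitBlockJacobi` implies cancellation of the FACTORED middle sum
`Σ_{x^θ < Q ≤ x^{θ′} prime} Σ_{ν mod Q, ν² ≡ −1} Σ_{s : ν + Qs ≤ x} (c_ν + 2νs | Q) · Σ_{Q′ ∣ R, Q′ > Q prime} (R/Q′ | Q)`
(`R = ((ν+Qs)²+1)/Q`, `c_ν = (ν²+1)/Q`) for all `1/2 < θ < θ′ < 1`: by
`middlePrimeJacobi_of_splitBlockJacobi` the middle-prime sum is `o(x)`, and for `x ≥ 4` it differs
from the factored sum by at most `12 (x^{θ′} + 1)` (`DigitReparam.abs_middle_sub_factored_le`),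
while `x^{θ′} = o(x)` (`DigitReparam.rpow_isLittleO_natCast`).  With
`splitBlockJacobi_of_middlePrimeJacobi` / `splitBlockJacobi_of_factoredMiddleCancels` (p76701) the
crux is EQUIVALENT to middle-prime / factored cancellation. -/
theorem factoredMiddleCancels_of_splitBlockJacobi :
    Summit.Parity.BatemanHorn.Theses.IsogenyRedei.SplitBlockJacobi → ∀ θ θ' : ℝ, 1 / 2 < θ →
      θ < θ' → θ' < 1 →
      (fun x : ℕ =>
        ∑ Q ∈ (Finset.range (x + 1)).filter
            (fun Q : ℕ => Q.Prime ∧ (x : ℝ) ^ θ < (Q : ℝ) ∧ (Q : ℝ) ≤ (x : ℝ) ^ θ'),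
          ∑ ν ∈ (Finset.range Q).filter (fun ν : ℕ => Q ∣ ν ^ 2 + 1),
            ∑ s ∈ (Finset.range (x + 1)).filter (fun s : ℕ => ν + Q * s ≤ x),
              (jacobiSym (((ν ^ 2 + 1) / Q + 2 * ν * s : ℕ) : ℤ) Q : ℝ) *
                ∑ Q' ∈ ((((ν + Q * s) ^ 2 + 1) / Q).primeFactors).filter (fun Q' : ℕ => Q < Q'),
                  (jacobiSym ((((ν + Q * s) ^ 2 + 1) / Q / Q' : ℕ) : ℤ) Q : ℝ))
        =o[Filter.atTop] fun x : ℕ => (x : ℝ) := by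
  intro hJ θ θ' hθ hθθ' hθ'1
  have hM := middlePrimeJacobi_of_splitBlockJacobi hJ θ θ' hθ hθθ' hθ'1
  rw [Asymptotics.isLittleO_iff] at hM ⊢
  intro c hc
  have hpow := rpow_isLittleO_natCast hθ'1
  rw [Asymptotics.isLittleO_iff] at hpow
  filter_upwards [hM (half_pos hc), hpow (show 0 < c / 48 by positivity),
    Filter.eventually_ge_atTop 4] with x hxM hxpow hx
  have h1 := abs_middle_sub_factored_le (θ := θ) hθ hθ'1.le hx
  rw [abs_sub_comm] at h1
  have h2 := (abs_sub_abs_le_abs_sub _ _).trans h1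
  have hx1 : (1 : ℝ) ≤ (x : ℝ) ^ θ' :=
    Real.one_le_rpow (by exact_mod_cast (show 1 ≤ x by omega)) (by linarith)
  rw [Real.norm_eq_abs, Real.norm_eq_abs, Nat.abs_cast] at hxM hxpow ⊢
  rw [abs_of_nonneg (by linarith : (0 : ℝ) ≤ (x : ℝ) ^ θ')] at hxpow
  linarith

/-! ### The equivalences -/

/-- **Equivalence** (line `split-mass-middle-prime`): the crux `SplitBlockJacobi` holds iff the
middle-prime Jacobi sum `M_{θ,θ′}(x)` is `o(x)` for all `1/2 < θ < θ′ < 1` — the converse (easy)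
direction `middlePrimeJacobi_of_splitBlockJacobi` of this file together with the landed
`splitBlockJacobi_of_middlePrimeJacobi` (p76701: transfer + split-mass bound). -/
theorem splitBlockJacobi_iff_middlePrimeJacobi :
    Summit.Parity.BatemanHorn.Theses.IsogenyRedei.SplitBlockJacobi ↔
      ∀ θ θ' : ℝ, 1 / 2 < θ → θ < θ' → θ' < 1 →
        (fun x : ℕ => ∑ t ∈ Finset.Icc 1 x,
            ∑ q ∈ ((t ^ 2 + 1).primeFactors ×ˢ (t ^ 2 + 1).primeFactors).filter
              (fun q : ℕ × ℕ => (x : ℝ) ^ θ < (q.1 : ℝ) ∧ (q.1 : ℝ) ≤ (x : ℝ) ^ θ' ∧ q.1 < q.2),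
              (jacobiSym (q.1 : ℤ) q.2 : ℝ))
          =o[Filter.atTop] fun x : ℕ => (x : ℝ) :=
  ⟨middlePrimeJacobi_of_splitBlockJacobi, splitBlockJacobi_of_middlePrimeJacobi⟩

/-- **Equivalence** (line `split-mass-middle-prime`): the crux `SplitBlockJacobi` holds iff the
FACTORED middle sum (in `(Q, ν, s)`-currency, `t = ν + Qs`, `ν² ≡ −1 (mod Q)`) is `o(x)` for all
`1/2 < θ < θ′ < 1` — the converse (easy) direction `factoredMiddleCancels_of_splitBlockJacobi` of
this file together with the landed `splitBlockJacobi_of_factoredMiddleCancels` (p76701: dictionary +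
transfer + split-mass bound).  In particular the open stub `stub_primalityCoupling` of the line,
whose conclusion is factored cancellation, is crux-EQUIVALENT. -/
theorem splitBlockJacobi_iff_factoredMiddleCancels :
    Summit.Parity.BatemanHorn.Theses.IsogenyRedei.SplitBlockJacobi ↔
      ∀ θ θ' : ℝ, 1 / 2 < θ → θ < θ' → θ' < 1 →
        (fun x : ℕ =>
          ∑ Q ∈ (Finset.range (x + 1)).filter
              (fun Q : ℕ => Q.Prime ∧ (x : ℝ) ^ θ < (Q : ℝ) ∧ (Q : ℝ) ≤ (x : ℝ) ^ θ'),
            ∑ ν ∈ (Finset.range Q).filter (fun ν : ℕ => Q ∣ ν ^ 2 + 1),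
              ∑ s ∈ (Finset.range (x + 1)).filter (fun s : ℕ => ν + Q * s ≤ x),
                (jacobiSym (((ν ^ 2 + 1) / Q + 2 * ν * s : ℕ) : ℤ) Q : ℝ) *
                  ∑ Q' ∈ ((((ν + Q * s) ^ 2 + 1) / Q).primeFactors).filter
                      (fun Q' : ℕ => Q < Q'),
                    (jacobiSym ((((ν + Q * s) ^ 2 + 1) / Q / Q' : ℕ) : ℤ) Q : ℝ))
          =o[Filter.atTop] fun x : ℕ => (x : ℝ) :=
  ⟨factoredMiddleCancels_of_splitBlockJacobi, splitBlockJacobi_of_factoredMiddleCancels⟩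

end Summit.Parity.BatemanHorn.Cruxes.SplitBlockJacobi.SplitMassMiddlePrime

end
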